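import Mathlib

/-!
# ValiantsHypothesis / RigidityForcesSymmetry — crux `LaplaceOptimalFive` (stmt-ValiantsHypothesis-24813), symmetric capture:
# **SPAN AND SUPPORT TOOLS** (pure linear algebra on `ℂ⁵` and `5 × 5 × 5` tensors; no capture vocabulary)

Small tools for the dimension counts of the profile-`(1,1,2)` files (val-port-2 g5, 2026-08-29): an abstract rank–nullity comparison of
two images of one submodule with a kernel correction, coordinate-support spans in `ℂ⁵`, and a support lemma for fully symmetric tensors
vanishing at repeated letters.

* `finrank_map_le_add` — `finrank Φ(R) ≤ finrank π(R) + finrank ρ(R ⊓ ker π)` when `ρ` is injective on `R ⊓ ker π`.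
* `mem_span_indicators`, `finrank_span_indicators_le` — a vector supported in `S` lies in the span of the `|S|` indicator vectors.
* `vanish_of_offpair_support` — a fully symmetric tensor vanishing at repeated letters, on the words `(i, j, ·)` and on all words with two
  letters outside `{i, j}`, vanishes.

Honest framing.  Tools only; nothing about `CaptureIneqSym`, K1, `LaplaceOptimalFive` (OPEN · CONTESTED 72/120) or `VP ≠ VNP` is proved
here.  No definitions, no `sorry`.
-/

set_option linter.dupNamespace false
set_option autoImplicit false

namespace Summit.ValiantsHypothesis.ValiantsHypothesis.Theorems.RigidityForcesSymmetryRankRigidMinimalRepr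

namespace LaplaceFiveSeparatedCapture

open Finset

/-- Abstract count: `finrank Φ(R) ≤ finrank π(R) + finrank ρ(R ⊓ ker π)` whenever `ρ` is injective on `R ⊓ ker π`. [folklore] -/
theorem finrank_map_le_add {X E Y Z : Type*} [AddCommGroup X] [Module ℂ X] [AddCommGroup E] [Module ℂ E]
    [AddCommGroup Y] [Module ℂ Y] [AddCommGroup Z] [Module ℂ Z] [FiniteDimensional ℂ X]
    (Φ : X →ₗ[ℂ] E) (π : X →ₗ[ℂ] Y) (ρ : X →ₗ[ℂ] Z) (R : Submodule ℂ X)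
    (hρ : ∀ x ∈ R, π x = 0 → ρ x = 0 → x = 0) :
    Module.finrank ℂ (R.map Φ) ≤ Module.finrank ℂ (R.map π) + Module.finrank ℂ ((R ⊓ LinearMap.ker π).map ρ) := by
  have e0 := Submodule.finrank_map_le Φ R
  have e2 := LinearMap.finrank_range_add_finrank_ker (π.domRestrict R)
  rw [LinearMap.range_domRestrict, LinearMap.ker_domRestrict] at e2
  have e3 : Module.finrank ℂ (Submodule.comap R.subtype (LinearMap.ker π))
      = Module.finrank ℂ ↥(R ⊓ LinearMap.ker π) := by
    rw [← Submodule.finrank_map_subtype_eq R (Submodule.comap R.subtype (LinearMap.ker π)), Submodule.map_comap_subtype]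
  have hinj : Function.Injective (ρ.domRestrict (R ⊓ LinearMap.ker π)) := by
    rw [injective_iff_map_eq_zero]
    intro x hx
    rw [LinearMap.domRestrict_apply] at hx
    obtain ⟨hxR, hxk⟩ := Submodule.mem_inf.mp x.2
    exact Subtype.ext (hρ x.1 hxR (LinearMap.mem_ker.mp hxk) hx)
  have e4 := LinearMap.finrank_range_of_inj hinj
  rw [LinearMap.range_domRestrict] at e4
  omega

/-- A vector supported in a finset `S` lies in the span of the indicator vectors of `S`. [folklore] -/
theorem mem_span_indicators (g : Fin 5 → ℂ) (S : Finset (Fin 5)) (hg : ∀ k, k ∉ S → g k = 0) :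
    g ∈ Submodule.span ℂ (↑(S.image fun k : Fin 5 => fun j : Fin 5 => if k = j then (1 : ℂ) else 0) :
      Set (Fin 5 → ℂ)) := by
  classical
  rw [pi_eq_sum_univ g]
  refine Submodule.sum_mem _ fun k _ => ?_
  by_cases hk : k ∈ S
  · exact Submodule.smul_mem _ _ (Submodule.subset_span (Finset.mem_coe.mpr (Finset.mem_image_of_mem _ hk)))
  · rw [hg k hk, zero_smul]; exact Submodule.zero_mem _

/-- The span of the indicator vectors of `S` has dimension at most `|S|`. [folklore] -/
theorem finrank_span_indicators_le (S : Finset (Fin 5)) :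
    Module.finrank ℂ (Submodule.span ℂ (↑(S.image fun k : Fin 5 => fun j : Fin 5 => if k = j then (1 : ℂ) else 0) :
      Set (Fin 5 → ℂ))) ≤ S.card :=
  (finrank_span_finset_le_card _).trans Finset.card_image_le

/-- Support lemma: a fully symmetric tensor vanishing at repeated letters, on the words `(i, j, ·)`, and on all words with two letters
outside `{i, j}`, vanishes identically. [folklore] -/
theorem vanish_of_offpair_support (T : Fin 5 → Fin 5 → Fin 5 → ℂ)
    (h12 : ∀ p q r, T p q r = T q p r) (h23 : ∀ p q r, T p q r = T p r q) (hrep : ∀ p r, T p p r = 0)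
    (i j : Fin 5) (h0 : ∀ k, T i j k = 0)
    (hA : ∀ p q r, p ≠ i → p ≠ j → q ≠ i → q ≠ j → T p q r = 0) (p q r : Fin 5) : T p q r = 0 := by
  have h13 : ∀ p q r, T p q r = T r q p := fun p q r => by rw [h12, h23, h12]
  have rep13 : ∀ p q, T p q p = 0 := fun p q => by rw [← h23]; exact hrep p q
  have rep23 : ∀ p q, T p q q = 0 := fun p q => by rw [h13, hrep]
  have hA13 : ∀ p q r, p ≠ i → p ≠ j → r ≠ i → r ≠ j → T p q r = 0 := fun p q r h1 h2 h3 h4 => by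
    rw [← h23]; exact hA p r q h1 h2 h3 h4
  have hA23 : ∀ p q r, q ≠ i → q ≠ j → r ≠ i → r ≠ j → T p q r = 0 := fun p q r h1 h2 h3 h4 => by
    rw [h12, ← h23]; exact hA q r p h1 h2 h3 h4
  have z3 : ∀ k, T i j k = 0 := h0
  have z3' : ∀ k, T j i k = 0 := fun k => by rw [h12]; exact h0 k
  have z2 : ∀ k, T i k j = 0 := fun k => by rw [← h23]; exact h0 k
  have z2' : ∀ k, T j k i = 0 := fun k => by rw [← h23]; exact z3' k
  have z1 : ∀ k, T k i j = 0 := fun k => by rw [h12]; exact z2 k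
  have z1' : ∀ k, T k j i = 0 := fun k => by rw [h12]; exact z2' k
  by_cases hp : p ≠ i ∧ p ≠ j
  · by_cases hq : q ≠ i ∧ q ≠ j
    · exact hA p q r hp.1 hp.2 hq.1 hq.2
    · by_cases hr : r ≠ i ∧ r ≠ j
      · exact hA13 p q r hp.1 hp.2 hr.1 hr.2
      · rw [not_and_or, not_ne_iff, not_ne_iff] at hq hr
        rcases hq with rfl | rfl <;> rcases hr with h | h <;> (subst h) <;>
          first | exact rep23 _ _ | exact z1 _ | exact z1' _
  · rw [not_and_or, not_ne_iff, not_ne_iff] at hp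
    by_cases hq : q ≠ i ∧ q ≠ j
    · by_cases hr : r ≠ i ∧ r ≠ j
      · exact hA23 p q r hq.1 hq.2 hr.1 hr.2
      · rw [not_and_or, not_ne_iff, not_ne_iff] at hr
        rcases hp with rfl | rfl <;> rcases hr with h | h <;> (subst h) <;>
          first | exact rep13 _ _ | exact z2 _ | exact z2' _
    · rw [not_and_or, not_ne_iff, not_ne_iff] at hq
      rcases hp with rfl | rfl <;> rcases hq with h | h <;> (subst h) <;>
        first | exact hrep _ _ | exact z3 _ | exact z3' _

end LaplaceFiveSeparatedCapture

end Summit.ValiantsHypothesis.ValiantsHypothesis.Theorems.RigidityForcesSymmetryRankRigidMinimalRepr
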